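import Literature.Probability.RandomPlanarGeometry.HexSAWSurfaceWallRenewalSlackFourThreeDownRuns
import HarnessLib

/-!
# Hexagonal-lattice SAWs at a surface: slack four — the seven linear systems of a `D D D U U U` block

Wall-renewal blocks of the brick-wall (hexagonal) half-plane walk (`ipwb m`: irreducible positive wall bridges of
length `m`) at slack four, `m = 6k + 4` with `k` wall visits, whose vertical profile is three down steps followed by
three up steps.  `…SlackFourThreeDownRuns` supplies the run decomposition (§1 there) and the pure-arithmetic table (§2
there): the constraint system LEN / VIS / PAR / SIGNS / ROW1 / ROW2 / WALL / XRNG / IRR on the first dive column `p`,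
the final wall run `f`, the run lengths `h₁ … h₅` and the vertical-step columns `c₁ … c₅` has exactly seven solution
families.  This file DERIVES that constraint system from the geometry of the block and concludes

* `ddduuu4_families` — for every such block with `k ≥ 2`, the columns `c₁ … c₅ = ω p₂ 0, ω p₃ 0, ω r₁ 0, ω r₂ 0, ω r₃ 0`
  and the step times satisfy one of seven explicit linear systems, the parameter sets of the table walks `s3a … s3g`
  (families A2, A3, A4, A5, A6, B2, B3 of `…SlackFourThreeDownFamilies`).

The geometric inputs: ROW1 / ROW2 — the two runs sharing row `−1` (resp. `−2`) occupy separated column intervals, by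
self-avoidance (`ddduuu4_runs_apart`, a generic two-runs-on-one-row lemma); WALL — the resurfacing column lies right of
the initial wall run (`ddduuu4_wall`); XRNG — the bridge property; IRR — the two shields forced by irreducibility
(`ddduuu4_shield_low/high`: the slack-two `ddduuu_shield_low/high` of `…SlackTwoClassification` with the resurfacing
column only assumed `≥ p + 1`); PAR — the brick-wall parity of vertical steps and of the endpoint.

What remains for the exact three-down count at slack four (`2 · #{visits = k, three down steps} = (k−1)(2k²+3k−4) + 2`,
certified by enumeration for `k ≤ 7`) is the identification of a walk satisfying one of the seven systems with the
corresponding table walk, as `dudduu_slack_four` does for the bump–hairpin profile.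

References: hexagonal-lattice SAW / connective constant `√(2+√2)` [DuminilCopinSmirnov2012]; surface exponents and
the wall-renewal (irreducible bridge) decomposition [MadrasSlade1993, §4.2 (Definition 4.2.1, p. 90), §1.2 (Definition
1.2.4, p. 11)]; series enumeration of SAW classes by profile [EntingJensen2009, §7.4.2, Fig. 7.10]; critical surface
fugacity `1 + √2` [BeatonEtAl2014].
-/

namespace Literature.Probability.RandomPlanarGeometry.SAW.HexBW.Wall

open Finset Filter Function
open Literature.Probability.LatticeModels Literature.Probability.Percolation SimpleGraph

variable {n : ℕ} {ω : ℕ → Site 2}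

/-- Two coordinates determine a site of `ℤ²` (plumbing). [folklore] -/
private theorem site_ext_dds {p q : Site 2} (h0 : p 0 = q 0) (h1 : p 1 = q 1) : p = q := by
  funext k
  fin_cases k
  · exact h0
  · exact h1

/-! ### §1  Geometry of the block: shields, shared rows, the resurfacing column -/

/-- **Shield below the visit `(2,0)`** (slack-free form of the tree's `ddduuu_shield_low`: the resurfacing column is
    only assumed `≥ p + 1`):
if the initial wall run carries a visit (`p ≥ 3`), some vertical-step column is `≤ 2`;
    else `2` is a wall-renewal time. [cite: MadrasSlade1993, §4.2, Definition 4.2.1; EntingJensen2009, §7.4.2,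
    Fig. 7.10] [cite: MadrasSlade1993, §4.2, Definition 4.2.1 (p. 90)] [cite: EntingJensen2009, §7.4.2, Fig. 7.10] -/
private theorem ddduuu4_shield_low {m p p₂ p₃ r₁ r₂ r₃ : ℕ} {e₁ e₂ e₃ e₄ e₅ : ℤ}
    (hbr : ∀ i, 1 ≤ i → i ≤ m → ω 0 0 < ω i 0 ∧ ω i 0 ≤ ω m 0) (hirr : ∀ t, 1 ≤ t → t < m → ¬ IsWRen m ω t)
    (hR0 : ∀ i, i ≤ p → ω i 0 = i ∧ ω i 1 = 0) (he₁ : e₁ = 1 ∨ e₁ = -1) (he₂ : e₂ = 1 ∨ e₂ = -1) (he₃ : e₃ = 1 ∨ e₃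
        = -1) (he₄ : e₄ = 1 ∨ e₄ = -1)
    (he₅ : e₅ = 1 ∨ e₅ = -1)
    (hrun1 : ∀ i, p + 1 ≤ i → i ≤ p₂ → ω i 0 = p + e₁ * ((i - (p + 1) : ℕ) : ℤ) ∧ ω i 1 = -1)
    (hrun2 : ∀ i, p₂ + 1 ≤ i → i ≤ p₃ → ω i 0 = ω p₂ 0 + e₂ * ((i - (p₂ + 1) : ℕ) : ℤ) ∧ ω i 1 = -2)
    (hrun3 : ∀ i, p₃ + 1 ≤ i → i ≤ r₁ → ω i 0 = ω p₃ 0 + e₃ * ((i - (p₃ + 1) : ℕ) : ℤ) ∧ ω i 1 = -3)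
    (hrun4 : ∀ i, r₁ + 1 ≤ i → i ≤ r₂ → ω i 0 = ω r₁ 0 + e₄ * ((i - (r₁ + 1) : ℕ) : ℤ) ∧ ω i 1 = -2)
    (hrun5 : ∀ i, r₂ + 1 ≤ i → i ≤ r₃ → ω i 0 = ω r₂ 0 + e₅ * ((i - (r₂ + 1) : ℕ) : ℤ) ∧ ω i 1 = -1)
    (hR6 : ∀ j, r₃ + 1 ≤ j → j ≤ m → ω j 0 = ω r₃ 0 + ((j - (r₃ + 1) : ℕ) : ℤ) ∧ ω j 1 = 0)
    (hp3 : 3 ≤ p) (h12 : p < p₂) (h23 : p₂ < p₃) (h3 : p₃ < r₁) (hr12 : r₁ < r₂) (hr23 : r₂ < r₃) (hsm : r₃ < m)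
    (hg2 : (p : ℤ) + 1 ≤ ω r₃ 0) (hb : ω p₂ 0 = p + e₁ * ((p₂ - (p + 1) : ℕ) : ℤ)) (hc : ω p₃ 0 = ω p₂ 0
        + e₂ * ((p₃ - (p₂ + 1) : ℕ) : ℤ))
    (hd : ω r₁ 0 = ω p₃ 0 + e₃ * ((r₁ - (p₃ + 1) : ℕ) : ℤ)) (he : ω r₂ 0 = ω r₁ 0 + e₄ * ((r₂ - (r₁ + 1) : ℕ) : ℤ))
    (hg : ω r₃ 0 = ω r₂ 0 + e₅ * ((r₃ - (r₂ + 1) : ℕ) : ℤ)) :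
    ω p₂ 0 ≤ 2 ∨ ω p₃ 0 ≤ 2 ∨ ω r₁ 0 ≤ 2 ∨ ω r₂ 0 ≤ 2 := by
  by_contra hcon
  simp only [not_or, not_le] at hcon
  obtain ⟨hb2, hc2, hd2, he2⟩ := hcon
  refine hirr 2 (by omega) (by omega) (isWRen_of_profile hbr (by omega) (by omega) (hR0 2 (by omega)).2 ?_ ?_)
  · intro i hi1 hi2; rw [(hR0 i (by omega)).1, (hR0 2 (by omega)).1]; omega
  · intro j hj1 hj2
    rw [(hR0 2 (by omega)).1]
    rcases Nat.lt_or_ge j (p + 1) with hj | hj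
    · rw [(hR0 j (by omega)).1]; omega
    rcases Nat.lt_or_ge j (p₂ + 1) with hja | hja
    · have := (hrun1 j hj (by omega)).1; rcases he₁ with rfl | rfl <;> omega
    rcases Nat.lt_or_ge j (p₃ + 1) with hjb | hjb
    · have := (hrun2 j hja (by omega)).1; rcases he₂ with rfl | rfl <;> omega
    rcases Nat.lt_or_ge j (r₁ + 1) with hjc | hjc
    · have := (hrun3 j hjb (by omega)).1; rcases he₃ with rfl | rfl <;> omega
    rcases Nat.lt_or_ge j (r₂ + 1) with hjd | hjd
    · have := (hrun4 j hjc (by omega)).1; rcases he₄ with rfl | rfl <;> omega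
    rcases Nat.lt_or_ge j (r₃ + 1) with hje | hje
    · have := (hrun5 j hjd (by omega)).1; rcases he₅ with rfl | rfl <;> omega
    · have := (hR6 j hje hj2).1; omega

/-- **Shield above the visit `(X − 2,
    0)`** (slack-free form of the tree's `ddduuu_shield_high`): if the final wall run carries two
visits (`r₃ + 4 ≤ m`), some vertical-step column is `≥ X − 1`;
    else `m − 2` is a wall-renewal time. [cite: MadrasSlade1993, §4.2, Definition 4.2.1; EntingJensen2009, §7.4.2,
    Fig. 7.10] [cite: MadrasSlade1993, §4.2, Definition 4.2.1 (p. 90)] [cite: EntingJensen2009, §7.4.2, Fig. 7.10] -/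
private theorem ddduuu4_shield_high {m p p₂ p₃ r₁ r₂ r₃ : ℕ} {e₁ e₂ e₃ e₄ e₅ : ℤ}
    (hbr : ∀ i, 1 ≤ i → i ≤ m → ω 0 0 < ω i 0 ∧ ω i 0 ≤ ω m 0) (hirr : ∀ t, 1 ≤ t → t < m → ¬ IsWRen m ω t)
    (hR0 : ∀ i, i ≤ p → ω i 0 = i ∧ ω i 1 = 0) (he₁ : e₁ = 1 ∨ e₁ = -1) (he₂ : e₂ = 1 ∨ e₂ = -1) (he₃ : e₃ = 1 ∨ e₃
        = -1) (he₄ : e₄ = 1 ∨ e₄ = -1)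
    (he₅ : e₅ = 1 ∨ e₅ = -1)
    (hrun1 : ∀ i, p + 1 ≤ i → i ≤ p₂ → ω i 0 = p + e₁ * ((i - (p + 1) : ℕ) : ℤ) ∧ ω i 1 = -1)
    (hrun2 : ∀ i, p₂ + 1 ≤ i → i ≤ p₃ → ω i 0 = ω p₂ 0 + e₂ * ((i - (p₂ + 1) : ℕ) : ℤ) ∧ ω i 1 = -2)
    (hrun3 : ∀ i, p₃ + 1 ≤ i → i ≤ r₁ → ω i 0 = ω p₃ 0 + e₃ * ((i - (p₃ + 1) : ℕ) : ℤ) ∧ ω i 1 = -3)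
    (hrun4 : ∀ i, r₁ + 1 ≤ i → i ≤ r₂ → ω i 0 = ω r₁ 0 + e₄ * ((i - (r₁ + 1) : ℕ) : ℤ) ∧ ω i 1 = -2)
    (hrun5 : ∀ i, r₂ + 1 ≤ i → i ≤ r₃ → ω i 0 = ω r₂ 0 + e₅ * ((i - (r₂ + 1) : ℕ) : ℤ) ∧ ω i 1 = -1)
    (hR6 : ∀ j, r₃ + 1 ≤ j → j ≤ m → ω j 0 = ω r₃ 0 + ((j - (r₃ + 1) : ℕ) : ℤ) ∧ ω j 1 = 0)
    (hs4 : r₃ + 4 ≤ m) (hm2 : m % 2 = 0) (h12 : p < p₂) (h23 : p₂ < p₃) (h3 : p₃ < r₁) (hr12 : r₁ < r₂)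
    (hr23 : r₂ < r₃) (hg2 : (p : ℤ) + 1 ≤ ω r₃ 0) (hb : ω p₂ 0 = p + e₁ * ((p₂ - (p + 1) : ℕ) : ℤ)) (hc : ω p₃ 0
        = ω p₂ 0 + e₂ * ((p₃ - (p₂ + 1) : ℕ) : ℤ))
    (hd : ω r₁ 0 = ω p₃ 0 + e₃ * ((r₁ - (p₃ + 1) : ℕ) : ℤ)) (he : ω r₂ 0 = ω r₁ 0 + e₄ * ((r₂ - (r₁ + 1) : ℕ) : ℤ))
    (hg : ω r₃ 0 = ω r₂ 0 + e₅ * ((r₃ - (r₂ + 1) : ℕ) : ℤ)) :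
    ω m 0 ≤ ω p₂ 0 + 1 ∨ ω m 0 ≤ ω p₃ 0 + 1 ∨ ω m 0 ≤ ω r₁ 0 + 1 ∨ ω m 0 ≤ ω r₂ 0 + 1 := by
  by_contra hcon
  simp only [not_or, not_le] at hcon
  obtain ⟨hb2, hc2, hd2, he2⟩ := hcon
  have hM2 := hR6 (m - 2) (by omega) (by omega)
  have hN := (hR6 m (by omega) le_rfl).1
  refine hirr (m - 2) (by omega) (by omega) (isWRen_of_profile hbr (by omega) (by omega) hM2.2 ?_ ?_)
  · intro i hi1 hi2
    rw [hM2.1]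
    rcases Nat.lt_or_ge i (p + 1) with hi | hi
    · rw [(hR0 i (by omega)).1]; omega
    rcases Nat.lt_or_ge i (p₂ + 1) with hia | hia
    · have := (hrun1 i hi (by omega)).1; rcases he₁ with rfl | rfl <;> omega
    rcases Nat.lt_or_ge i (p₃ + 1) with hib | hib
    · have := (hrun2 i hia (by omega)).1; rcases he₂ with rfl | rfl <;> omega
    rcases Nat.lt_or_ge i (r₁ + 1) with hic | hic
    · have := (hrun3 i hib (by omega)).1; rcases he₃ with rfl | rfl <;> omega
    rcases Nat.lt_or_ge i (r₂ + 1) with hid | hid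
    · have := (hrun4 i hic (by omega)).1; rcases he₄ with rfl | rfl <;> omega
    rcases Nat.lt_or_ge i (r₃ + 1) with hie | hie
    · have := (hrun5 i hid (by omega)).1; rcases he₅ with rfl | rfl <;> omega
    · have := (hR6 i hie (by omega)).1; omega
  · intro j hj1 hj2
    rw [hM2.1, (hR6 j (by omega) hj2).1]; omega

/-- **Two runs on one row are separated**: if run A (times `tA+1 … uA`, start column `a`, velocity `eA
    = ±1`) and run B (times
`tB+1 … uB`, start column `c`, velocity `eB`) never share a column,
    then all of A's columns lie strictly left of all of B's, or
strictly right — stated on the four end columns. [folklore] -/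
private theorem ddduuu4_runs_apart {a c eA eB : ℤ} {tA uA tB uB : ℕ} (heA : eA = 1 ∨ eA = -1) (heB : eB = 1 ∨ eB = -1)
    (htA : tA + 1 ≤ uA) (htB : tB + 1 ≤ uB)
    (hA : ∀ i, tA + 1 ≤ i → i ≤ uA → ω i 0 = a + eA * ((i - (tA + 1) : ℕ) : ℤ))
    (hB : ∀ j, tB + 1 ≤ j → j ≤ uB → ω j 0 = c + eB * ((j - (tB + 1) : ℕ) : ℤ))
    (hne : ∀ i j, tA + 1 ≤ i → i ≤ uA → tB + 1 ≤ j → j ≤ uB → ω i 0 ≠ ω j 0) :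
    (a < c ∧ a < ω uB 0 ∧ ω uA 0 < c ∧ ω uA 0 < ω uB 0) ∨ (c < a ∧ ω uB 0 < a ∧ c < ω uA 0 ∧ ω uB 0 < ω uA 0) := by
  have hAe := hA uA htA le_rfl
  have hBe := hB uB htB le_rfl
  -- the column sets are the integer intervals between the end columns; if they met, two sites would coincide in column
  by_contra hcon
  have key : ∀ x : ℤ, (min a (ω uA 0) ≤ x ∧ x ≤ max a (ω uA 0)) → (min c (ω uB 0) ≤ x ∧ x ≤ max c (ω uB 0))
      → False := by
    intro x hxA hxB
    have hiA : ∃ i, tA + 1 ≤ i ∧ i ≤ uA ∧ ω i 0 = x := by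
      refine ⟨tA + 1 + (x - a).natAbs, by omega, ?_, ?_⟩
      · rcases heA with rfl | rfl <;> simp only [min_def, max_def] at hxA <;> split_ifs at hxA <;> omega
      · rw [hA _ (by omega) (by rcases heA with rfl | rfl <;> simp only [min_def,
          max_def] at hxA <;> split_ifs at hxA <;> omega)]
        rcases heA with rfl | rfl <;> simp only [min_def, max_def] at hxA <;> split_ifs at hxA <;> omega
    have hiB : ∃ j, tB + 1 ≤ j ∧ j ≤ uB ∧ ω j 0 = x := by
      refine ⟨tB + 1 + (x - c).natAbs, by omega, ?_, ?_⟩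
      · rcases heB with rfl | rfl <;> simp only [min_def, max_def] at hxB <;> split_ifs at hxB <;> omega
      · rw [hB _ (by omega) (by rcases heB with rfl | rfl <;> simp only [min_def,
          max_def] at hxB <;> split_ifs at hxB <;> omega)]
        rcases heB with rfl | rfl <;> simp only [min_def, max_def] at hxB <;> split_ifs at hxB <;> omega
    obtain ⟨i, hi1, hi2, hix⟩ := hiA
    obtain ⟨j, hj1, hj2, hjx⟩ := hiB
    exact hne i j hi1 hi2 hj1 hj2 (by rw [hix, hjx])
  -- the intervals meet at `max (min-ends)` unless separated
  rcases le_or_gt (min a (ω uA 0)) (min c (ω uB 0)) with h | h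
  · refine key (min c (ω uB 0)) ⟨h, ?_⟩ ⟨le_rfl, min_le_max⟩
    simp only [min_def, max_def] at hcon h ⊢; split_ifs at hcon h ⊢ <;> omega
  · refine key (min a (ω uA 0)) ⟨le_rfl, min_le_max⟩ ⟨h.le, ?_⟩
    simp only [min_def, max_def] at hcon h ⊢; split_ifs at hcon h ⊢ <;> omega

/-- **The resurfacing column lies right of the initial wall run**: `ω r₃ 0 ≥ p + 1` (the wall site `(ω r₃ 0,
    0)` reached at time
`r₃ + 1` is not one of the sites `(i, 0)`, `i ≤ p`, of the initial run). [folklore] -/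
private theorem ddduuu4_wall {m p r₃ : ℕ} (hinj : Set.InjOn ω {i | i ≤ m})
    (hpos : ∀ i, 1 ≤ i → i ≤ m → 0 < ω i 0) (hpr : p < r₃) (hr3 : r₃ < m)
    (hR0 : ∀ i, i ≤ p → ω i 0 = i ∧ ω i 1 = 0)
    (hR6 : ∀ j, r₃ + 1 ≤ j → j ≤ m → ω j 0 = ω r₃ 0 + ((j - (r₃ + 1) : ℕ) : ℤ) ∧ ω j 1 = 0) : (p : ℤ) + 1 ≤ ω r₃ 0 := by
  by_contra hlt
  have hS := hR6 (r₃ + 1) le_rfl (by omega)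
  have hx0 : 0 ≤ ω r₃ 0 := by have := hpos (r₃ + 1) (by omega) (by omega); rw [hS.1] at this; omega
  obtain ⟨x, hx⟩ := Int.eq_ofNat_of_zero_le hx0
  have hxp : x ≤ p := by omega
  have hmem : ∀ i, i ≤ m → i ∈ {i | i ≤ m} := fun i hi => hi
  have := hinj (hmem (r₃ + 1) (by omega)) (hmem x (by omega))
    (site_ext_dds (by rw [hS.1, (hR0 x hxp).1, hx]; omega) (by rw [hS.2, (hR0 x hxp).2]))
  omega

/-! ### §2  The seven linear systems -/

/-- **The seven families of `D D D U U U` blocks at slack four.**  For an irreducible positive wall bridge of length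
`6k + 4` (`k ≥ 2`) with `k` wall visits, three down steps `p₁ < p₂ < p₃` before three up steps `r₁ < r₂ < r₃`, and the
initial wall run `0 … p₁` followed by the first dive, the vertical-step columns `c₁ … c₅ = ω p₂ 0, ω p₃ 0, ω r₁ 0,
    ω r₂ 0,
ω r₃ 0` and the step times satisfy one of seven linear systems — the parameter sets of the table walks `s3a … s3g`
(families A2, A3, A4, A5, A6, B2, B3 of `…SlackFourThreeDownFamilies`), in this order.  Proof: the runs (§1),
self-avoidance on the shared rows `−1` and `−2` (`ddduuu4_runs_apart`), the position of the resurfacing column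
(`ddduuu4_wall`), the two shields forced by irreducibility (`ddduuu4_shield_low/high`), and the integer table (§2).
OURS — the hexagonal analogue of enumerating irreducible bridges by their dives. [cite: MadrasSlade1993, §4.2,
Definition 4.2.1 (p. 90); §1.2, Definition 1.2.4 (p. 11)] [cite: EntingJensen2009, §7.4.2, Fig. 7.10] -/
theorem ddduuu4_families {k m : ℕ} (hk : 2 ≤ k) (hm : m = 6 * k + 4) (hω : ω ∈ ipwb m) (hv : visits m ω = k)
    {p₁ p₂ p₃ r₁ r₂ r₃ : ℕ} (hD : stepsD m ω = {p₁, p₂, p₃}) (hU : stepsU m ω = {r₁, r₂, r₃}) (h12 : p₁ < p₂)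
    (h23 : p₂ < p₃) (hr12 : r₁ < r₂) (hr23 : r₂ < r₃) (h3 : p₃ < r₁) (hp1 : 1 ≤ p₁)
    (hR0 : ∀ i, i ≤ p₁ → ω i 0 = i ∧ ω i 1 = 0) (hP1x : ω (p₁ + 1) 0 = p₁) (hP1y : ω (p₁ + 1) 1 = -1)
    (hhor : ∀ i, i < m → i ∉ stepsD m ω → i ∉ stepsU m ω →
      ω (i + 1) 1 = ω i 1 ∧ (ω (i + 1) 0 = ω i 0 + 1 ∨ ω (i + 1) 0 = ω i 0 - 1)) :
    ∃ c1 c2 c3 c4 c5 : ℕ, (c1 : ℤ) = ω p₂ 0 ∧ (c2 : ℤ) = ω p₃ 0 ∧ (c3 : ℤ) = ω r₁ 0 ∧ (c4 : ℤ) = ω r₂ 0 ∧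
      (c5 : ℤ) = ω r₃ 0 ∧ r₃ + 2 * k + 1 = m + p₁ ∧ (
      (p₁ = 1 ∧ c1 = 2 ∧ c2 = 2 + (p₃ - p₂ - 1) ∧ c3 = 2 * k + 1 ∧ c4 + (r₂ - r₁ - 1) = c3 ∧ c5 = 3 ∧ (p₃ - p₂ - 1)
          + (r₂
      - r₁ - 1) + 2 ≤ 2 * k) ∨ (c2 = 1 ∧ c1 + (p₂ - p₁ - 1) = p₁ ∧ c3 = 2 * k + 1 ∧ c4 + (r₂ - r₁ - 1) = c3 ∧ c5
          = p₁ + 2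
      ∧ 3 ≤ p₁ ∧ 3 ≤ (m - r₃ - 1)) ∨ (p₁ + 1 = 2 * k ∧ c2 = 1 ∧ c1 + (p₂ - p₁ - 1) = p₁ ∧ c3 = 1 + (r₁ - p₃ - 1)
          ∧ c4 = 2
      * k ∧ c5 = 2 * k + 1 ∧ 2 * k ≤ (p₂ - p₁ - 1) + (r₁ - p₃ - 1) + 1) ∨ (c1 = 2 ∧ c2 = 2 + (p₃ - p₂ - 1) ∧ c3
          = 2 * k +
      1 ∧ c4 = p₁ + 1 ∧ c5 = p₁ + 2 ∧ (p₃ - p₂ - 1) + 2 ≤ p₁) ∨ (c1 = 2 ∧ c2 = 2 + (p₃ - p₂ - 1) ∧ c3 = c2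
          + (r₁ - p₃ - 1)
      ∧ c4 = 2 * k + 2 ∧ c5 = p₁ + 2 ∧ 3 ≤ p₁) ∨ (c1 = 2 ∧ c2 = 2 + (p₃ - p₂ - 1) ∧ c3 = 2 * k + 3 ∧ c4
          + (r₂ - r₁ - 1) =
      c3 ∧ c5 = p₁ + 4 ∧ (p₃ - p₂ - 1) + (r₂ - r₁ - 1) ≤ 2 * k ∧ 3 ≤ (m - r₃ - 1)) ∨ (p₁ + 1 = 2 * k ∧ c1 = 2 ∧ c2 = 2 +
      (p₃ - p₂ - 1) ∧ c3 = c2 + (r₁ - p₃ - 1) ∧ c4 = c3 + (r₂ - r₁ - 1) ∧ c5 = 2 * k + 3 ∧ (r₃ - r₂ - 1) ≤ 3)) := by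
  classical
  obtain ⟨hpw, hn1, hirr⟩ := mem_ipwb.1 hω
  obtain ⟨hw, hbr⟩ := mem_pwb.1 hpw
  obtain ⟨ha, -⟩ := mem_wbr.1 hw
  obtain ⟨hh, -, -⟩ := mem_archs.1 ha
  obtain ⟨hs, hhp⟩ := mem_hpw.1 hh
  obtain ⟨h0, -, hbw, hinj⟩ := mem_saws_iff.1 hs
  have hX0 : ω 0 0 = 0 := by rw [h0]; rfl
  have hb' : ∀ i, 1 ≤ i → i ≤ m → 0 < ω i 0 ∧ ω i 0 ≤ ω m 0 := fun i h1 h2 => by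
    have := hbr i h1 h2; rwa [hX0] at this
  have hmem : ∀ i, i ≤ m → i ∈ {i | i ≤ m} := fun i hi => hi
  have hmD : ∀ i, i ∈ stepsD m ω ↔ i = p₁ ∨ i = p₂ ∨ i = p₃ := fun i => by
    rw [hD]; simp only [Finset.mem_insert, Finset.mem_singleton]
  obtain ⟨-, -, -, hppar1⟩ := of_mem_stepsD_coord hbw (i := p₁) ((hmD _).2 (by simp))
  have hpodd : p₁ % 2 = 1 := by rw [hP1x, hP1y] at hppar1; omega
  obtain ⟨e₁, e₂, e₃, e₄, e₅, he₁, he₂, he₃, he₄, he₅, hrun1, hrun2, hrun3, hrun4, hrun5, hR6, hs_eq, hN, hbev, hcodd,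
    hdodd, heev, hb1, hc1, hd1, he1, hq2, hq3, hr2, hr3m⟩ :=
    ddduuu4_runs hm hω hv hD hU h12 h23 hr12 hr23 h3 hp1 hR0 hP1x hP1y hhor
  -- the end columns of the five body runs
  have hB := (hrun1 p₂ (by omega) le_rfl).1
  have hC := (hrun2 p₃ (by omega) le_rfl).1
  have hDD := (hrun3 r₁ (by omega) le_rfl).1
  have hE := (hrun4 r₂ (by omega) le_rfl).1
  have hG := (hrun5 r₃ (by omega) le_rfl).1
  -- `X` is even (time `m` is even and `ω m` lies on the wall), so `c₅ = X + p₁ − 2k` is odd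
  have hXev : ω m 0 % 2 = 0 := by
    have := parity_apply hs (i := m) le_rfl; rw [(hR6 m (by omega) le_rfl).2] at this; omega
  -- the resurfacing column lies right of the initial run
  have hwall : (p₁ : ℤ) + 1 ≤ ω r₃ 0 := ddduuu4_wall hinj (fun i h1 h2 => (hb' i h1 h2).1) (by omega) hr3m hR0 hR6
  -- rows −1 and −2 are shared: the two runs on each are separated
  have hrow1 := ddduuu4_runs_apart (a := (p₁ : ℤ)) (c := ω r₂ 0) he₁ he₅ (show p₁ + 1 ≤ p₂ by omega)
    (show r₂ + 1 ≤ r₃ by omega) (fun i h1 h2 => (hrun1 i h1 h2).1) (fun j h1 h2 => (hrun5 j h1 h2).1)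
    (fun i j hi1 hi2 hj1 hj2 hx => by
      have := hinj (hmem i (by omega)) (hmem j (by omega))
        (site_ext_dds hx (by rw [(hrun1 i hi1 hi2).2, (hrun5 j hj1 hj2).2]))
      omega)
  have hrow2 := ddduuu4_runs_apart (a := ω p₂ 0) (c := ω r₁ 0) he₂ he₄ (show p₂ + 1 ≤ p₃ by omega)
    (show r₁ + 1 ≤ r₂ by omega) (fun i h1 h2 => (hrun2 i h1 h2).1) (fun j h1 h2 => (hrun4 j h1 h2).1)
    (fun i j hi1 hi2 hj1 hj2 hx => by
      have := hinj (hmem i (by omega)) (hmem j (by omega))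
        (site_ext_dds hx (by rw [(hrun2 i hi1 hi2).2, (hrun4 j hj1 hj2).2]))
      omega)
  -- sign-free end-column relations
  have E1 : ω p₂ 0 = p₁ + ((p₂ - p₁ - 1 : ℕ) : ℤ) ∨ ω p₂ 0 + ((p₂ - p₁ - 1 : ℕ) : ℤ) = p₁ := by
    rcases he₁ with rfl | rfl <;> omega
  have E2 : ω p₃ 0 = ω p₂ 0 + ((p₃ - p₂ - 1 : ℕ) : ℤ) ∨ ω p₃ 0 + ((p₃ - p₂ - 1 : ℕ) : ℤ) = ω p₂ 0 := by
    rcases he₂ with rfl | rfl <;> omega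
  have E3 : ω r₁ 0 = ω p₃ 0 + ((r₁ - p₃ - 1 : ℕ) : ℤ) ∨ ω r₁ 0 + ((r₁ - p₃ - 1 : ℕ) : ℤ) = ω p₃ 0 := by
    rcases he₃ with rfl | rfl <;> omega
  have E4 : ω r₂ 0 = ω r₁ 0 + ((r₂ - r₁ - 1 : ℕ) : ℤ) ∨ ω r₂ 0 + ((r₂ - r₁ - 1 : ℕ) : ℤ) = ω r₁ 0 := by
    rcases he₄ with rfl | rfl <;> omega
  have E5 : ω r₃ 0 = ω r₂ 0 + ((r₃ - r₂ - 1 : ℕ) : ℤ) ∨ ω r₃ 0 + ((r₃ - r₂ - 1 : ℕ) : ℤ) = ω r₂ 0 := by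
    rcases he₅ with rfl | rfl <;> omega
  -- the two shields (irreducibility)
  have hlo : p₁ ≤ 2 ∨ ω p₂ 0 ≤ 2 ∨ ω p₃ 0 ≤ 2 ∨ ω r₁ 0 ≤ 2 ∨ ω r₂ 0 ≤ 2 := by
    rcases Nat.lt_or_ge p₁ 3 with h | h
    · exact Or.inl (by omega)
    · exact Or.inr (ddduuu4_shield_low hbr hirr hR0 he₁ he₂ he₃ he₄ he₅ hrun1 hrun2 hrun3 hrun4 hrun5 hR6 h h12 h23 h3
        hr12 hr23 hr3m hwall hB hC hDD hE hG)
  have hhi : m - r₃ - 1 ≤ 2 ∨ ω m 0 ≤ ω p₂ 0 + 1 ∨ ω m 0 ≤ ω p₃ 0 + 1 ∨ ω m 0 ≤ ω r₁ 0 + 1 ∨ ω m 0 ≤ ω r₂ 0 + 1 := by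
    rcases Nat.lt_or_ge (m - r₃ - 1) 3 with h | h
    · exact Or.inl (by omega)
    · exact Or.inr (ddduuu4_shield_high hbr hirr hR0 he₁ he₂ he₃ he₄ he₅ hrun1 hrun2 hrun3 hrun4 hrun5 hR6 (by omega)
        (by omega) h12 h23 h3 hr12 hr23 hwall hB hC hDD hE hG)
  -- the bridge range
  have X1 := (hb' p₂ (by omega) (by omega)).2
  have X2 := (hb' p₃ (by omega) (by omega)).2
  have X3 := (hb' r₁ (by omega) (by omega)).2
  have X4 := (hb' r₂ (by omega) (by omega)).2
  -- integer columns, and the hypotheses of the table one by one (each `omega` sees few disjunctions)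
  obtain ⟨c1, hC1⟩ := Int.eq_ofNat_of_zero_le hb1.le
  obtain ⟨c2, hC2⟩ := Int.eq_ofNat_of_zero_le hc1.le
  obtain ⟨c3, hC3⟩ := Int.eq_ofNat_of_zero_le hd1.le
  obtain ⟨c4, hC4⟩ := Int.eq_ofNat_of_zero_le he1.le
  obtain ⟨c5, hC5⟩ := Int.eq_ofNat_of_zero_le (show (0 : ℤ) ≤ ω r₃ 0 by omega)
  clear hrun1 hrun2 hrun3 hrun4 hrun5 hR6 hhor hmD hR0 hb' hbr hirr hB hC hDD hE hG he₁ he₂ he₃ he₄ he₅ hppar1 hP1x hP1y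
    hmem hinj hbw
  refine ⟨c1, c2, c3, c4, c5, hC1.symm, hC2.symm, hC3.symm, hC4.symm, hC5.symm, hs_eq, ?_⟩
  have row1 : (p₁ < c4 ∧ p₁ < c5 ∧ c1 < c4 ∧ c1 < c5) ∨ (c4 < p₁ ∧ c5 < p₁ ∧ c4 < c1 ∧ c5 < c1) := by
    clear E1 E2 E3 E4 E5 hrow2 hlo hhi; omega
  have row2 : (c1 < c3 ∧ c1 < c4 ∧ c2 < c3 ∧ c2 < c4) ∨ (c3 < c1 ∧ c4 < c1 ∧ c3 < c2 ∧ c4 < c2) := by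
    clear E1 E2 E3 E4 E5 hrow1 hlo hhi row1; omega
  clear hrow1 hrow2
  have lo : p₁ ≤ 2 ∨ c1 ≤ 2 ∨ c2 ≤ 2 ∨ c3 ≤ 2 ∨ c4 ≤ 2 ∨ c5 ≤ 2 := by
    clear E1 E2 E3 E4 E5 hhi row1 row2; omega
  have hi : m - r₃ - 1 ≤ 2 ∨ c5 + (m - r₃ - 1) ≤ c1 + 1 ∨ c5 + (m - r₃ - 1) ≤ c2 + 1 ∨ c5 + (m - r₃ - 1) ≤ c3 + 1 ∨
      c5 + (m - r₃ - 1) ≤ c4 + 1 ∨ c5 + (m - r₃ - 1) ≤ p₁ + 1 := by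
    clear E1 E2 E3 E4 E5 hlo row1 row2 lo; omega
  clear hlo hhi
  have e1 : c1 = p₁ + (p₂ - p₁ - 1) ∨ c1 + (p₂ - p₁ - 1) = p₁ := by clear E2 E3 E4 E5 row1 row2 lo hi; omega
  have e2 : c2 = c1 + (p₃ - p₂ - 1) ∨ c2 + (p₃ - p₂ - 1) = c1 := by clear E1 E3 E4 E5 row1 row2 lo hi e1; omega
  have e3 : c3 = c2 + (r₁ - p₃ - 1) ∨ c3 + (r₁ - p₃ - 1) = c2 := by clear E1 E2 E4 E5 row1 row2 lo hi e1 e2; omega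
  have e4 : c4 = c3 + (r₂ - r₁ - 1) ∨ c4 + (r₂ - r₁ - 1) = c3 := by
    clear E1 E2 E3 E5 row1 row2 lo hi e1 e2 e3; omega
  have e5 : c5 = c4 + (r₃ - r₂ - 1) ∨ c5 + (r₃ - r₂ - 1) = c4 := by
    clear E1 E2 E3 E4 row1 row2 lo hi e1 e2 e3 e4; omega
  clear E1 E2 E3 E4 E5
  have hp1' : (p₂ - p₁ - 1) % 2 = 1 := by clear e2 e3 e4 e5 row1 row2 lo hi; omega
  have hp2' : (p₃ - p₂ - 1) % 2 = 1 := by clear e1 e3 e4 e5 row1 row2 lo hi; omega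
  have hp3' : (r₁ - p₃ - 1) % 2 = 0 := by clear e1 e2 e4 e5 row1 row2 lo hi; omega
  have hp4' : (r₂ - r₁ - 1) % 2 = 1 := by clear e1 e2 e3 e5 row1 row2 lo hi; omega
  have hp5' : (r₃ - r₂ - 1) % 2 = 1 := by clear e1 e2 e3 e4 row1 row2 lo hi; omega
  have hh4 : 1 ≤ r₂ - r₁ - 1 := by clear e1 e2 e3 e5 row1 row2 lo hi; omega
  have hh5 : 1 ≤ r₃ - r₂ - 1 := by clear e1 e2 e3 e4 row1 row2 lo hi; omega
  have X1' : c1 ≤ c5 + (m - r₃ - 1) := by clear e1 e2 e3 e4 e5 row1 row2 lo hi; omega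
  have X2' : c2 ≤ c5 + (m - r₃ - 1) := by clear e1 e2 e3 e4 e5 row1 row2 lo hi; omega
  have X3' : c3 ≤ c5 + (m - r₃ - 1) := by clear e1 e2 e3 e4 e5 row1 row2 lo hi; omega
  have X4' : c4 ≤ c5 + (m - r₃ - 1) := by clear e1 e2 e3 e4 e5 row1 row2 lo hi; omega
  have wall' : p₁ + 1 ≤ c5 := by clear e1 e2 e3 e4 e5 row1 row2 lo hi; omega
  exact ddduuu4_int_table (k := k) (p := p₁) (f := m - r₃ - 1) (h1 := p₂ - p₁ - 1) (h2 := p₃ - p₂ - 1)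
    (h3 := r₁ - p₃ - 1) (h4 := r₂ - r₁ - 1) (h5 := r₃ - r₂ - 1) (c1 := c1) (c2 := c2) (c3 := c3) (c4 := c4) (c5 := c5)
    hk (by clear e1 e2 e3 e4 e5 row1 row2 lo hi; omega) (by clear e1 e2 e3 e4 e5 row1 row2 lo hi; omega)
    (by clear e1 e2 e3 e4 e5 row1 row2 lo hi; omega) hpodd hp1' hp2' hp3' hp4' hp5'
    (by clear e1 e2 e3 e4 e5 row1 row2 lo hi; omega) (by clear e1 e2 e3 e4 e5 row1 row2 lo hi; omega)
    (by clear e1 e2 e3 e4 e5 row1 row2 lo hi; omega) hh4 hh5 e1 e2 e3 e4 e5 row1 row2 wall'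
    (by clear e1 e2 e3 e4 e5 row1 row2 lo hi; omega) (by clear e1 e2 e3 e4 e5 row1 row2 lo hi; omega)
    (by clear e1 e2 e3 e4 e5 row1 row2 lo hi; omega) (by clear e1 e2 e3 e4 e5 row1 row2 lo hi; omega)
    X1' X2' X3' X4' lo hi

end Literature.Probability.RandomPlanarGeometry.SAW.HexBW.Wall
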